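import Literature.MathematicalPhysics.QuantumLattice.SymmetricLocalCertificate
import Literature.MathematicalPhysics.QuantumLattice.FockRelabel
import Literature.MathematicalPhysics.QuantumLattice.HubbardRingPerronFrobeniusProofs
import Literature.MathematicalPhysics.QuantumLattice.FreeFermiGasNoPairFieldLRO
import HarnessLib

/-!
# Translation-averaged bootstrap certificates on the Hubbard torus: a certificate for a local
# energy bounds the ground-state energy PER SITE

Family `hubbard` (topic `MathematicalPhysics/QuantumLattice`). The Hubbard instance of
`Matrix.re_projState_ge_of_local_certificate` (SymmetricLocalCertificate): on the fermionic torus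
`(ℤ/Lℤ)^d` with `H = hubbardTorus d L t U`, sector `K = szSector (2n) 0` (which carries the
`2n`-particle ground-state energy, `groundEnergyAt_eq_minEnergyOn_szSector`) and the translation
unitaries `U_v = fockTranslate v` (commuting with `H`, preserving the sectors), an identity in the
torus algebra for a LOCAL energy `X` whose translates sum to the Hamiltonian,
`Σ_v U_v X U_vᴴ = H` (e.g. `X = Γ(ι) E_Φ`, `sum_relabel_translate_hubbard_meanEnergyObs`),

  `X − c·1 − Σᵢ μᵢ (Dᵢ − νᵢ·1) = Σ Λₐᵦ Oₐᴴ O_b + (Σ[H, X_k] + Σ(Uₗ Yₗ Uₗᴴ − Yₗ) + Σ(Zᵣ(Qᵣ − qᵣ) + (Qᵣ − qᵣ)Z'ᵣ)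
      + Σⱼ (Cⱼ Wⱼ − Wⱼ Cⱼ)) + (Σₘ dₘ • (Vₘᴴ − Vₘ) + Σₖ aₖ • Mₖ)`

— with density-type constraint observables `Dᵢ` whose translates sum to operators `Gᵢ` acting as
the real scalars `gᵢ` on `K` (`n_{xσ}`: `Σ_v U_v n_{xσ} U_vᴴ = N_σ = ½N̂ ± S^z`, acting as `n` on
`szSector (2n) 0`, `sum_conj_fockTranslate_numberOp`, `spinNumber_mulVec_of_mem_szSector`) —
proves the certified bound PER SITE

  `c − Σₖ ‖aₖ‖ + Σᵢ μᵢ (gᵢ / L^d − νᵢ) ≤ groundEnergyAt (fermionTorusGraph d L) t U (2n) / L^d`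

(`hubbardTorus_groundEnergyAt_div_ge_of_local_certificate`). This is the finite-torus soundness
statement of a translation-invariant ("reduce"-mode, thermodynamic-limit) certificate of the bundle
papers/HubbardSuperconductivity/manybody-bootstrap/ (format `certsdp/1` §3): X. Han,
arXiv:2006.06002 (2020) §2–3. Combined with `energyDensity2D_ge_of_eventually_ge_torus`
(HubbardEnergyDensityCertificateLimit) it yields thermodynamic-limit bounds. Everything is PROVED;
no definition, no named fact.

## References
* X. Han, *Quantum many-body bootstrap*, arXiv:2006.06002 (2020), §2 eq. (2)–(3), §3.
  [cite: Han2020Bootstrap, §3]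
* O. Bratteli, D. W. Robinson, *Operator Algebras and Quantum Statistical Mechanics II*, 2nd ed.,
  §6.2.4 (periodic boundary conditions, energy per site). [cite: BratteliRobinsonII1997, §6.2.4]
* E. H. Lieb, PRL 62 (1989) 1201 (sectors `(N, S^z)`; `S^z = 0` suffices). [cite: LiebPRL1989]
-/

noncomputable section

namespace Literature.MathematicalPhysics.QuantumLattice

open Matrix Finset HubbardWave0 Literature.Probability.LatticeModels
open Literature.MathematicalPhysics.QuantumManyBody.StateRelaxation
open scoped ComplexOrder BigOperators

section Torus

variable {d L : ℕ} [NeZero L]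

/-- (Local to this file, as in `DopedRVBState`.) Equality of torus sites is decided through the
LINEAR ORDER — the instance the Jordan–Wigner matrices, `relabel`, `fockRelabel` and every
orbital-generic lemma of the tree carry once specialised to `Λ = FermionTorus d L`; the structural
`Lex/Pi/Fin` instance found at the concrete type is only propositionally equal to it (implementation
notes of `FockRelabel`, `ProjectedBCSState`, `DopedRVBState`). No library instance is overridden
outside this file. [folklore] -/
local instance (priority := high) instDecidableEqFermionTorusLocal : DecidableEq (FermionTorus d L) :=
  LinearOrder.toDecidableEq

/-! ### The translation unitaries as symmetries of the sector problem -/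

/-- `U_vᴴ = U_{-v}` for the translation unitaries. [folklore] -/
theorem fockTranslate_val_conjTranspose (v : TorusSite d L) :
    (fockTranslate v).valᴴ = (fockTranslate (-v)).val := by
  rw [fockTranslate_neg]
  rfl

/-- `U_vᴴ U_v = 1`. [folklore] -/
theorem fockTranslate_conjTranspose_mul_self (v : TorusSite d L) :
    (fockTranslate v).valᴴ * (fockTranslate v).val = 1 := by
  have h := fockRelabel_conjTranspose_mul_self (Orb.translate v (d := d) (L := L))
  rw [← fockRelabel_val] at h
  exact h

/-- `U_v H = H U_v` for the torus Hubbard Hamiltonian. [folklore] -/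
theorem fockTranslate_mul_hubbardTorus (v : TorusSite d L) (t U : ℝ) :
    (fockTranslate v).val * hubbardTorus d L t U = hubbardTorus d L t U * (fockTranslate v).val :=
  (fockTranslate_commute_hubbardTorus v t U).eq

/-- `U_vᴴ` preserves the joint sectors. [folklore] -/
theorem fockTranslate_conjTranspose_mulVec_mem_szSector (v : TorusSite d L) {N : ℕ} {M : ℝ}
    {ψ : Fock (Orb (FermionTorus d L))} (hψ : ψ ∈ szSector N M) :
    (fockTranslate v).valᴴ *ᵥ ψ ∈ szSector N M := by
  rw [fockTranslate_val_conjTranspose]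
  exact fockTranslate_mulVec_mem_szSector (-v) hψ

/-- The torus has `L^d` sites. [folklore] -/
theorem card_torusSite : Fintype.card (TorusSite d L) = L ^ d := by
  simp [ZMod.card, Fintype.card_fin]

omit [NeZero L] in
/-- The torus Hubbard Hamiltonian preserves the joint sectors `(N, S^z = M)`. [cite: LiebPRL1989] -/
theorem mulVec_hubbardTorus_mem_szSector (t U : ℝ) {N : ℕ} {M : ℝ}
    {ψ : Fock (Orb (FermionTorus d L))} (hψ : ψ ∈ szSector N M) :
    hubbardTorus d L t U *ᵥ ψ ∈ szSector N M :=
  mulVec_mem_szSector_of_commute (hamiltonian_isHermitian_and_commute_holds _ t U).2.1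
    (hamiltonian_isHermitian_and_commute_holds _ t U).2.2 hψ

omit [NeZero L] in
/-- The sector `(2n, S^z = 0)` of the torus is non-trivial for `n ≤ L^d`. [cite: LiebPRL1989] -/
theorem szSector_ne_bot (t U : ℝ) {nh : ℕ} (hn : nh ≤ Fintype.card (FermionTorus d L)) :
    (szSector (2 * nh) 0 : Submodule ℂ (Fock (Orb (FermionTorus d L)))) ≠ ⊥ := by
  obtain ⟨⟨ψ, hψK, hψ0, -⟩, -⟩ := szSector_groundState (fermionTorusGraph d L) t U hn
  exact (Submodule.ne_bot_iff _).2 ⟨ψ, hψK, hψ0⟩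

/-! ### Translates of the local densities -/

/-- **The translates of `n_{xσ}` sum to the spin-`σ` particle number**:
`Σ_v U_v n_{xσ} U_vᴴ = Σ_y n_{yσ}`. [cite: BratteliRobinsonII1997, §6.2.4] -/
theorem sum_conj_fockTranslate_numberOp (x : TorusSite d L) (σ : Fin 2) :
    ∑ v : TorusSite d L, (fockTranslate v).val * numberOp (FermionTorus.ofTorusSite x) σ *
        (fockTranslate v).valᴴ = ∑ y : FermionTorus d L, numberOp y σ := by
  have hstep : ∀ v : TorusSite d L, (fockTranslate v).val * numberOp (FermionTorus.ofTorusSite x) σ *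
      (fockTranslate v).valᴴ = numberOp (FermionTorus.ofTorusSite (x + v)) σ := fun v => by
    rw [← relabel_eq_fockRelabel_conj, relabel_translate_numberOp]
  simp_rw [hstep]
  exact Fintype.sum_equiv ((Equiv.addLeft x).trans FermionTorus.equivTorusSite.symm) _ _ fun v => rfl

/-- `N_↑ = ½ N̂ + S^z` and `N_↓ = ½ N̂ − S^z`, in the form `N_σ = ½ N̂ ± S^z`. [cite: LiebPRL1989, eq. (2)] -/
theorem sum_numberOp_eq_half_totalNumber_add_spinZ {Λ : Type*} [LinearOrder Λ] [Fintype Λ] (σ : Fin 2) :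
    ∑ y : Λ, numberOp y σ =
      (1 / 2 : ℂ) • (totalNumber : Matrix (Finset (Orb Λ)) (Finset (Orb Λ)) ℂ) +
        (if σ = 0 then (1 : ℂ) else -1) • HubbardWave0.spinZ := by
  rw [totalNumber, HubbardWave0.spinZ, smul_smul, Finset.smul_sum, Finset.smul_sum, ← Finset.sum_add_distrib]
  refine Finset.sum_congr rfl fun y _ => ?_
  rw [Fin.sum_univ_two]
  fin_cases σ
  · simp only [Fin.zero_eta, Fin.isValue, if_true, one_mul, smul_add, smul_sub]
    module
  · simp only [Fin.mk_one, Fin.isValue, one_ne_zero, if_false, smul_add, smul_sub]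
    module

/-- **On the sector `(N, S^z = 0)` the spin-`σ` number acts as `N/2`**: `(Σ_y n_{yσ}) ψ = (N/2) ψ`.
[cite: LiebPRL1989, eq. (2)] -/
theorem spinNumber_mulVec_of_mem_szSector {Λ : Type*} [LinearOrder Λ] [Fintype Λ] (σ : Fin 2)
    {N : ℕ} {ψ : Fock (Orb Λ)} (hψ : ψ ∈ szSector N 0) :
    (∑ y : Λ, numberOp y σ) *ᵥ ψ = (((N : ℝ) / 2 : ℝ) : ℂ) • ψ := by
  obtain ⟨hN, hS⟩ := (mem_szSector_iff N 0 ψ).1 hψ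
  rw [sum_numberOp_eq_half_totalNumber_add_spinZ, Matrix.add_mulVec, Matrix.smul_mulVec,
    Matrix.smul_mulVec, totalNumber_mulVec_of_isNParticle hN, hS, Complex.ofReal_zero, zero_smul,
    smul_zero, add_zero, smul_smul]
  congr 1
  push_cast
  ring

/-- The spin-`σ` number is Hermitian. [folklore] -/
theorem isHermitian_sum_numberOp {Λ : Type*} [LinearOrder Λ] [Fintype Λ] (σ : Fin 2) :
    (∑ y : Λ, numberOp y σ).IsHermitian := by
  show (∑ y : Λ, numberOp y σ)ᴴ = ∑ y : Λ, numberOp y σ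
  rw [Matrix.conjTranspose_sum]
  refine Finset.sum_congr rfl fun y _ => ?_
  rw [numberOp, Matrix.conjTranspose_mul, annihilation_conjTranspose, creation_conjTranspose]

/-! ### The certificate for a local energy on the torus -/

/-- **Translation-averaged certificate ⇒ ground-state energy per site (Hubbard torus).** Let
`H = hubbardTorus d L t U`, `K = szSector (2n) 0` (`n ≤ L^d`), `U_v = fockTranslate v`. Suppose the
translates of a local energy `X` sum to `H`, `Σ_v U_v X U_vᴴ = H`, the translates of constraint
observables `Dᵢ` sum to Hermitian `Gᵢ` acting as the real scalars `gᵢ` on `K`, and the torus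
algebra carries the identity
`X − c·1 − Σᵢ μᵢ (Dᵢ − νᵢ·1) = Σ Λₐᵦ Oₐᴴ O_b + (Σₖ (H Xₖ − Xₖ H) + Σₗ (Uₗ Yₗ Uₗᴴ − Yₗ)
  + Σᵣ (Zᵣ (Qᵣ − qᵣ) + (Qᵣ − qᵣ) Z'ᵣ) + Σⱼ (Cⱼ Wⱼ − Wⱼ Cⱼ)) + (Σₘ dₘ • (Vₘᴴ − Vₘ) + Σₖ aₖ • Mₖ)`
with `Λ ⪰ 0`, symmetries `Uₗ` / charges `Cⱼ` commuting with `H` and (with their adjoints) preserving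
`K`, `Uₗᴴ Uₗ = 1`, Hermitian `Qᵣ = qᵣ` on `K`, real `dₘ`, contractions `Mₖ`. Then
`c − Σₖ ‖aₖ‖ + Σᵢ μᵢ (gᵢ / L^d − νᵢ) ≤ groundEnergyAt (fermionTorusGraph d L) t U (2n) / L^d`.
(The `(2n, S^z = 0)` sector carries the `2n`-particle ground energy,
`groundEnergyAt_eq_minEnergyOn_szSector`.) Han 2020 §2–3 (translation-invariant bootstrap of the
energy per site), evaluated in the tracial sector ground state of the periodic box
(Bratteli–Robinson II §6.2.4). NOTE for users at a concrete torus: elaborate the identity with the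
order-derived `DecidableEq (FermionTorus d L)` (`LinearOrder.toDecidableEq`, as the local instance of
this file), the instance all orbital-generic lemmas carry. [cite: Han2020Bootstrap, §3] -/
theorem hubbardTorus_groundEnergyAt_div_ge_of_local_certificate (t U : ℝ) {nh : ℕ}
    (hn : nh ≤ Fintype.card (FermionTorus d L))
    (X : Matrix (Finset (Orb (FermionTorus d L))) (Finset (Orb (FermionTorus d L))) ℂ)
    (hsum : ∑ v : TorusSite d L, (fockTranslate v).val * X * (fockTranslate v).valᴴ =
      hubbardTorus d L t U)
    {δ' : Type*} (dens : Finset δ') (μ ν g : δ' → ℝ)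
    (D G : δ' → Matrix (Finset (Orb (FermionTorus d L))) (Finset (Orb (FermionTorus d L))) ℂ)
    (hD : ∀ i ∈ dens, ∑ v : TorusSite d L, (fockTranslate v).val * D i * (fockTranslate v).valᴴ = G i)
    (hGh : ∀ i ∈ dens, (G i).IsHermitian)
    (hG : ∀ i ∈ dens, ∀ ψ ∈ (szSector (2 * nh) 0 : Submodule ℂ (Fock (Orb (FermionTorus d L)))),
      G i *ᵥ ψ = ((g i : ℝ) : ℂ) • ψ)
    {m : Type*} [Fintype m] [DecidableEq m] {Λm : Matrix m m ℂ} (hΛ : Λm.PosSemidef)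
    (O : m → Matrix (Finset (Orb (FermionTorus d L))) (Finset (Orb (FermionTorus d L))) ℂ)
    {κ : Type*} (s : Finset κ)
    (Xc : κ → Matrix (Finset (Orb (FermionTorus d L))) (Finset (Orb (FermionTorus d L))) ℂ)
    {ι : Type*} (tt : Finset ι)
    (Us Y : ι → Matrix (Finset (Orb (FermionTorus d L))) (Finset (Orb (FermionTorus d L))) ℂ)
    (hU : ∀ l ∈ tt, Us l * hubbardTorus d L t U = hubbardTorus d L t U * Us l)
    (hUK : ∀ l ∈ tt, ∀ ψ ∈ (szSector (2 * nh) 0 : Submodule ℂ (Fock (Orb (FermionTorus d L)))),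
      Us l *ᵥ ψ ∈ (szSector (2 * nh) 0 : Submodule ℂ (Fock (Orb (FermionTorus d L)))))
    (hUK' : ∀ l ∈ tt, ∀ ψ ∈ (szSector (2 * nh) 0 : Submodule ℂ (Fock (Orb (FermionTorus d L)))),
      (Us l)ᴴ *ᵥ ψ ∈ (szSector (2 * nh) 0 : Submodule ℂ (Fock (Orb (FermionTorus d L)))))
    (hUU : ∀ l ∈ tt, (Us l)ᴴ * Us l = 1)
    {ρ : Type*} (r : Finset ρ)
    (Q Z Z' : ρ → Matrix (Finset (Orb (FermionTorus d L))) (Finset (Orb (FermionTorus d L))) ℂ)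
    (q : ρ → ℝ) (hQh : ∀ i ∈ r, (Q i).IsHermitian)
    (hQ : ∀ i ∈ r, ∀ ψ ∈ (szSector (2 * nh) 0 : Submodule ℂ (Fock (Orb (FermionTorus d L)))),
      Q i *ᵥ ψ = ((q i : ℝ) : ℂ) • ψ)
    {γ : Type*} (u : Finset γ)
    (C W : γ → Matrix (Finset (Orb (FermionTorus d L))) (Finset (Orb (FermionTorus d L))) ℂ)
    (hC : ∀ j ∈ u, C j * hubbardTorus d L t U = hubbardTorus d L t U * C j)
    (hCK : ∀ j ∈ u, ∀ ψ ∈ (szSector (2 * nh) 0 : Submodule ℂ (Fock (Orb (FermionTorus d L)))),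
      C j *ᵥ ψ ∈ (szSector (2 * nh) 0 : Submodule ℂ (Fock (Orb (FermionTorus d L)))))
    (hCK' : ∀ j ∈ u, ∀ ψ ∈ (szSector (2 * nh) 0 : Submodule ℂ (Fock (Orb (FermionTorus d L)))),
      (C j)ᴴ *ᵥ ψ ∈ (szSector (2 * nh) 0 : Submodule ℂ (Fock (Orb (FermionTorus d L)))))
    {δ : Type*} (ah : Finset δ) (dc : δ → ℝ)
    (V : δ → Matrix (Finset (Orb (FermionTorus d L))) (Finset (Orb (FermionTorus d L))) ℂ)
    {κ'' : Type*} (w : Finset κ'') (a : κ'' → ℂ)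
    (M : κ'' → Matrix (Finset (Orb (FermionTorus d L))) (Finset (Orb (FermionTorus d L))) ℂ)
    (hM : ∀ k ∈ w, (M k).IsContraction) {c : ℝ}
    (hcert : X - (c : ℂ) • (1 : Matrix (Finset (Orb (FermionTorus d L))) (Finset (Orb (FermionTorus d L))) ℂ) -
        ∑ i ∈ dens, ((μ i : ℝ) : ℂ) • (D i - ((ν i : ℝ) : ℂ) •
          (1 : Matrix (Finset (Orb (FermionTorus d L))) (Finset (Orb (FermionTorus d L))) ℂ)) =
      gramForm Λm O +
        (∑ k ∈ s, (hubbardTorus d L t U * Xc k - Xc k * hubbardTorus d L t U) +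
          ∑ l ∈ tt, (Us l * Y l * (Us l)ᴴ - Y l) +
          ∑ i ∈ r, (Z i * (Q i - ((q i : ℝ) : ℂ) • 1) + (Q i - ((q i : ℝ) : ℂ) • 1) * Z' i) +
          ∑ j ∈ u, (C j * W j - W j * C j)) +
        (∑ m' ∈ ah, ((dc m' : ℝ) : ℂ) • ((V m')ᴴ - V m') + ∑ k ∈ w, a k • M k)) :
    c - ∑ k ∈ w, ‖a k‖ + ∑ i ∈ dens, μ i * (g i / (L : ℝ) ^ d - ν i) ≤
      groundEnergyAt (fermionTorusGraph d L) t U (2 * nh) / (L : ℝ) ^ d := by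
  set A := hubbardTorus d L t U with hAdef
  set K : Submodule ℂ (Fock (Orb (FermionTorus d L))) := szSector (2 * nh) 0 with hKdef
  have hA : A.IsHermitian := hubbardTorus_isHermitian (hamiltonian_isHermitian_and_commute_holds _) t U
  have hKA : ∀ ψ ∈ K, A *ᵥ ψ ∈ K := fun ψ hψ => mulVec_hubbardTorus_mem_szSector t U hψ
  have hK : K ≠ ⊥ := szSector_ne_bot t U hn
  -- the objective with the density constraints folded in
  set X' := X - ∑ i ∈ dens, ((μ i : ℝ) : ℂ) • (D i - ((ν i : ℝ) : ℂ) •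
    (1 : Matrix (Finset (Orb (FermionTorus d L))) (Finset (Orb (FermionTorus d L))) ℂ)) with hX'
  have hcert' : X' - (c : ℂ) • (1 : Matrix (Finset (Orb (FermionTorus d L))) (Finset (Orb (FermionTorus d L))) ℂ) =
      gramForm Λm O +
        (∑ k ∈ s, (A * Xc k - Xc k * A) + ∑ l ∈ tt, (Us l * Y l * (Us l)ᴴ - Y l) +
          ∑ i ∈ r, (Z i * (Q i - ((q i : ℝ) : ℂ) • 1) + (Q i - ((q i : ℝ) : ℂ) • 1) * Z' i) +
          ∑ j ∈ u, (C j * W j - W j * C j)) +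
        (∑ m' ∈ ah, ((dc m' : ℝ) : ℂ) • ((V m')ᴴ - V m') + ∑ k ∈ w, a k • M k) := by
    rw [hX', sub_right_comm]
    exact hcert
  have h := Matrix.re_projState_ge_of_local_certificate hA K hKA hK X' hΛ O s Xc tt Us Y hU hUK hUK'
    hUU r Q Z Z' q hQh hQ u C W hC hCK hCK' ah dc V w a M hM hcert'
  -- evaluation of the objective and of the constraint observables in the tracial state
  set P := A.sectorGroundProj K with hP
  have hPh : P.IsHermitian := sectorGroundProj_isHermitian A K
  have hP2 : P * P = P := sectorGroundProj_mul_self A K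
  have hP0 : P ≠ 0 := sectorGroundProj_ne_zero hA K hKA hK
  have hPA : P * A = ((A.minEnergyOn K : ℝ) : ℂ) • P := sectorGroundProj_mul hA K
  set ω := P.projState with hω
  have hone : ω 1 = 1 := projState_one hPh hP2 hP0
  have hPT : ∀ v : TorusSite d L, P * (fockTranslate v).val = (fockTranslate v).val * P := fun v =>
    sectorGroundProj_commute hA K (fockTranslate_mul_hubbardTorus v t U)
      (fun ψ hψ => fockTranslate_mulVec_mem_szSector v hψ)
      (fun ψ hψ => fockTranslate_conjTranspose_mulVec_mem_szSector v hψ)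
  have hTT : ∀ v : TorusSite d L, (fockTranslate v).valᴴ * (fockTranslate v).val = 1 :=
    fockTranslate_conjTranspose_mul_self
  have hωX : ω X = ((A.minEnergyOn K : ℝ) : ℂ) / (Fintype.card (TorusSite d L) : ℂ) :=
    projState_eq_div_of_sum_conj hPh hP2 hP0 hPA (fun v => (fockTranslate v).val) hPT hTT hsum
  have hωD : ∀ i ∈ dens, ω (D i) = ((g i : ℝ) : ℂ) / (Fintype.card (TorusSite d L) : ℂ) := by
    intro i hi
    have hPG : P * G i = ((g i : ℝ) : ℂ) • P := by
      have h0 := sectorGroundProj_mul_sub_smul A K (hGh i hi) (hG i hi)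
      rw [Matrix.mul_sub, Matrix.mul_smul, Matrix.mul_one, sub_eq_zero] at h0
      exact h0
    exact projState_eq_div_of_sum_conj hPh hP2 hP0 hPG (fun v => (fockTranslate v).val) hPT hTT (hD i hi)
  have hωX' : ω X' = ((A.minEnergyOn K : ℝ) : ℂ) / (Fintype.card (TorusSite d L) : ℂ) -
      ∑ i ∈ dens, ((μ i : ℝ) : ℂ) * (((g i : ℝ) : ℂ) / (Fintype.card (TorusSite d L) : ℂ) - ((ν i : ℝ) : ℂ)) := by
    rw [hX', map_sub, map_sum, hωX]
    congr 1
    refine Finset.sum_congr rfl fun i hi => ?_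
    rw [map_smul, map_sub, map_smul, hone, hωD i hi, smul_eq_mul, smul_eq_mul, mul_one]
  have hre : (ω X').re = A.minEnergyOn K / (L : ℝ) ^ d - ∑ i ∈ dens, μ i * (g i / (L : ℝ) ^ d - ν i) := by
    rw [hωX', card_torusSite]
    have e : ((A.minEnergyOn K : ℝ) : ℂ) / ((L ^ d : ℕ) : ℂ) -
        ∑ i ∈ dens, ((μ i : ℝ) : ℂ) * (((g i : ℝ) : ℂ) / ((L ^ d : ℕ) : ℂ) - ((ν i : ℝ) : ℂ)) =
        ((A.minEnergyOn K / (L : ℝ) ^ d - ∑ i ∈ dens, μ i * (g i / (L : ℝ) ^ d - ν i) : ℝ) : ℂ) := by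
      push_cast
      rfl
    rw [e, Complex.ofReal_re]
  rw [hre] at h
  have hE : A.minEnergyOn K = groundEnergyAt (fermionTorusGraph d L) t U (2 * nh) :=
    (groundEnergyAt_eq_minEnergyOn_szSector (fermionTorusGraph d L) t U hn).symm
  rw [hE] at h
  linarith

end Torus

end Literature.MathematicalPhysics.QuantumLattice
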